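import Summits.CriticalPhenomena.PercolationContinuityZ3.Theorems.PercNearOneGluingNoHeavyRsw3VolumeMomentBounds
import Summits.CriticalPhenomena.PercolationContinuityZ3.Theorems.PercNearOneGluingNoHeavyRsw3VolumePointSums
import Summits.CriticalPhenomena.PercolationContinuityZ3.Theorems.PercNearOneGluingNoHeavyRsw3VolumeMomentTools
import Summits.CriticalPhenomena.PercolationContinuityZ3.Theorems.PercNearOneGluingNoHeavyRsw3IICVolumeLower
import Summits.CriticalPhenomena.PercolationContinuityZ3.Theorems.PercAnnulusCrossingIICTwoPointUpper
import HarnessLib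

/-!
# RSW3 lane (P2, gen 21): KESTEN'S THEOREM (8) IN ALL MOMENTS, VI — the incipient infinite cluster:
# `E_ν|C ∩ Λ(n)|^t ≍ (n^d π_{p_c}(n))^t` for every `t ≥ 1` on `ℤ^d` under (A2)□ (+ count tightness for the lower half); `ℤ²` unconditional

builds on p205010 (kernel theorem, internal audit signed; external expert review pending) — used only through the EXISTENCE of
Kesten's IIC at `p_c(ℤ^d)` under (A2)□ (p1, `kestenIICExistsAt_criticalProbI_of_setToSetQuasiMultAspectAt`, which uses `θ(p_c) = 0`)
in the packaged corollary; the `ν`-statements hold for every Kesten-limit measure `ν` without it.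

Cell `prim-rsw3`, prover seat `prim-rsw3-p2` (gen 21), memo `run/shared/lean/prim/rsw3/P2-RSWLITE.md` §28.
Support file (`--supports stmt-CriticalPhenomena-4575`); no definitions, no named facts, no sorries.

Kesten 1986, Theorem (8), first display: `E_ν{[#(W̃ ∩ S(n))]^t} ≍ [n²π_n]^t`, `t ≥ 1`, for the planar IIC.  Here, with
`V_n = |C(0) ∩ Λ(n)|`, `s(n) = n^d π_{p_c}(n)`, for every measure `ν` with Kesten's IIC limit property at `p_c(ℤ^d)`:

* §1 `iicMeasure_real_iInter_openConn_le` — **`ν(⋂_i {0 ↔ q_i}) ≤ W(S(q)) / (c · π_{p_c}(2n+1))`** for `q : Fin t → Λ(n)` (part IV-b with the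
  exterior arm, divided by `π(N)`, `N → ∞`; one-arm quasi-multiplicativity `c π(2n+1) P(Λ(2n+1) ↔ ∂ⁱⁿΛ(N)) ≤ π(N)`; the events
  `⋂_i {0 ↔ q_i in Λ(m)}` are cylinders increasing to `⋂_i {0 ↔ q_i}`);
* §2 **`iicMeasure_integral_volume_pow_le`** — (A2)□ at `p_c(ℤ^d)` ⇒ `∀ t ∃ C ∀ n ≥ 1: E_ν V_n^{t+1} ≤ C · (n^d π_{p_c}(n))^{t+1}`
  (KESTEN'S (8), UPPER HALF, EVERY MOMENT, every `d`, for every Kesten-limit `ν`);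
* §2b `iicMeasure_real_volume_ge_le` — Markov: `ν{λ s(n) ≤ V_n} ≤ C_t λ^{−(t+1)}` for every `t` (super-polynomial upper tail of the IIC volume);
* §3 **`iicMeasure_integral_volume_pow_two_sided`** — with tightness of the annulus crossing-cluster count at one aspect (gen 20's lower
  tail `le_iicMeasure_real_volume_ge` + Markov): `c (n^dπ(n))^{t+1} ≤ E_ν V_n^{t+1} ≤ C (n^dπ(n))^{t+1}` — KESTEN'S THEOREM (8), all `t`;
  packaged with existence: `exists_iicMeasure_volume_pow_two_sided`; `ℤ³` under `AnnulusClusterCountTight`;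
* §4 **`exists_iicMeasure_volume_pow_two_sided_Z2`** — `ℤ²` at `p_c = 1/2`, UNCONDITIONALLY: Kesten's own theorem for bond percolation.

References: H. Kesten, Probab. Theory Relat. Fields 73 (1986) 369–394, Thm. (8) [Kesten1986]; C. Borgs, J. Chayes, H. Kesten,
J. Spencer, Comm. Math. Phys. 224 (2001) [BorgsChayesKestenSpencer2001]; D. Basu, A. Sapozhnikov, ECP 22 (2017) [BasuSapozhnikov2017ECP].
[folklore]
-/

noncomputable section

namespace Summit.CriticalPhenomena.PercolationContinuityZ3.Theorems

namespace Rsw3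

open MeasureTheory Filter Topology Literature.Probability.LatticeModels Literature.Probability.Percolation
open SurfaceTension Crossing SimpleGraph Finset
open Literature.Barriers.CriticalPhenomena (openConn_zero_eq_iUnion_openConnIn openConnIn_box_mono)
open scoped Literature.Probability.Percolation

variable {d : ℕ}

/-! ## §1 The `t`-point function of a Kesten-limit measure -/

/-- `⋂_i {0 ↔ q_i} = ⋃_m ⋂_i {0 ↔ q_i in Λ(m)}` (finitely many increasing unions commute with the intersection). [folklore] -/
theorem iInter_openConn_eq_iUnion_iInter_openConnIn {t : ℕ} (q : Fin t → Site d) :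
    (⋂ i, (openConn (0 : Site d) (q i) : Set (BondConfig (Site d)))) =
      ⋃ m : ℕ, ⋂ i, (openConnIn (↑(box d m) : Set (Site d)) (0 : Site d) (q i) : Set (BondConfig (Site d))) := by
  rw [Set.iUnion_iInter_of_monotone fun i => openConnIn_box_mono (q i)]
  exact Set.iInter_congr fun i => openConn_zero_eq_iUnion_openConnIn (q i)

/-- The finite-box `t`-point events increase with the box. [folklore] -/
theorem iInter_openConnIn_box_mono {t : ℕ} (q : Fin t → Site d) :
    Monotone fun m : ℕ => ⋂ i, (openConnIn (↑(box d m) : Set (Site d)) (0 : Site d) (q i) : Set (BondConfig (Site d))) :=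
  fun _ _ hmm' => Set.iInter_mono fun i => openConnIn_box_mono (q i) hmm'

/-- **The `t`-point function of a Kesten-limit measure** (every `p > 0`, `d ≥ 1`, one-arm quasi-multiplicativity with constant `c > 0`):
for `q : Fin t → Λ(n)`,
`ν(⋂_i {0 ↔ q_i}) ≤ W(S(q)) / (c · π_p(2n+1))`
— for each box `Λ(m)`: `ν(⋂_i {0 ↔ q_i in Λ(m)}) = lim_N P(⋂ ∩ {0 ↔ ∂ⁱⁿΛ(N)})/π(N) ≤ W(S(q)) · limsup P(Λ(2n+1) ↔ ∂ⁱⁿΛ(N))/π(N)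
≤ W(S(q))/(cπ(2n+1))` (part IV-b), then `m → ∞`. [cite: Kesten1986, Thm. (8), (41)–(45)] -/
theorem iicMeasure_real_iInter_openConn_le (hd : 1 ≤ d) (p : unitInterval) (hp : 0 < (p : ℝ)) {c : ℝ} (hc : 0 < c)
    (hQM : OneArmQuasiMultAt d p c) {ν : Measure (BondConfig (Site d))} [IsFiniteMeasure ν]
    (hν : ∀ (K : Finset (Sym2 (Site d))) (E : Set (BondConfig (Site d))), MeasurableSet E → DeterminedBy E ↑K →
      Tendsto (fun n : ℕ => (bondPercolation (zdGraph d) p).real (E ∩ siteToBoundary d n) / oneArmProb d p n)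
        atTop (𝓝 (ν.real E)))
    {t n : ℕ} {q : Fin t → Site d} (hq : q ∈ Fintype.piFinset (fun _ : Fin t => box d n)) :
    ν.real (⋂ i, (openConn (0 : Site d) (q i) : Set (BondConfig (Site d)))) ≤
      (∏ x ∈ insert (0 : Site d) (Finset.univ.image q),
        oneArmProb d p ((((Finset.erase (insert (0 : Site d) (Finset.univ.image q)) x).inf
          (fun w => ((Site.supNorm (x - w) : ℕ) : ℕ∞))).toNat - 1) / 2)) / (c * oneArmProb d p (2 * n + 1)) := by
  classical
  set μ := bondPercolation (zdGraph d) p with hμ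
  set W : ℝ := ∏ x ∈ insert (0 : Site d) (Finset.univ.image q),
        oneArmProb d p ((((Finset.erase (insert (0 : Site d) (Finset.univ.image q)) x).inf
          (fun w => ((Site.supNorm (x - w) : ℕ) : ℕ∞))).toNat - 1) / 2) with hW
  have hπ : ∀ m, 0 < oneArmProb d p m := oneArmProb_pos hd p hp
  have hW0 : 0 ≤ W := Finset.prod_nonneg fun x _ => measureReal_nonneg
  set Bd : ℝ := W / (c * oneArmProb d p (2 * n + 1)) with hBd
  have hBd0 : 0 ≤ Bd := div_nonneg hW0 (mul_nonneg hc.le (hπ _).le)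
  -- each finite-box event is a cylinder, and its `ν`-measure is bounded by `Bd`
  have hbox : ∀ m : ℕ, ν.real (⋂ i, (openConnIn (↑(box d m) : Set (Site d)) (0 : Site d) (q i) : Set (BondConfig (Site d)))) ≤ Bd := by
    intro m
    have hloc : IsLocalEvent (⋂ i, (openConnIn (↑(box d m) : Set (Site d)) (0 : Site d) (q i) : Set (BondConfig (Site d)))) :=
      ⟨(box d m).sym2, DeterminedBy.iInter fun i =>
        DCT16.determinedBy_openConnIn (↑(box d m)) 0 (q i) (K := ↑(box d m).sym2) (by rw [Finset.coe_sym2])⟩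
    refine le_of_tendsto (tendsto_iicMeasure_of_isLocalEvent p hν hloc) ?_
    refine eventually_atTop.2 ⟨2 * n + 1, fun N hN => ?_⟩
    have h1 : μ.real ((⋂ i, (openConnIn (↑(box d m) : Set (Site d)) (0 : Site d) (q i) : Set (BondConfig (Site d)))) ∩
        siteToBoundary d N) ≤ W * μ.real (boxCrossing d (2 * n + 1) N) := by
      refine le_trans (measureReal_mono ?_) (real_iInter_openConn_inter_siteToBoundary_le_weight_mul hd p hq hN)
      exact Set.inter_subset_inter_left _ (Set.iInter_mono fun i => openConnIn_subset_openConn _ _ _)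
    have hqm := hQM (2 * n + 1) N (by omega) hN
    rw [div_le_iff₀ (hπ N), hBd, div_mul_eq_mul_div, le_div_iff₀ (mul_pos hc (hπ _))]
    calc μ.real ((⋂ i, (openConnIn (↑(box d m) : Set (Site d)) (0 : Site d) (q i) : Set (BondConfig (Site d)))) ∩
          siteToBoundary d N) * (c * oneArmProb d p (2 * n + 1))
        ≤ W * μ.real (boxCrossing d (2 * n + 1) N) * (c * oneArmProb d p (2 * n + 1)) :=
          mul_le_mul_of_nonneg_right h1 (mul_nonneg hc.le (hπ _).le)
      _ = W * (c * (oneArmProb d p (2 * n + 1) * μ.real (boxCrossing d (2 * n + 1) N))) := by ring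
      _ ≤ W * oneArmProb d p N := mul_le_mul_of_nonneg_left hqm hW0
  -- pass to the increasing union
  have hlim := tendsto_measure_iUnion_atTop (μ := ν) (iInter_openConnIn_box_mono (d := d) q)
  rw [← iInter_openConn_eq_iUnion_iInter_openConnIn q] at hlim
  have hle : ν (⋂ i, (openConn (0 : Site d) (q i) : Set (BondConfig (Site d)))) ≤ ENNReal.ofReal Bd := by
    refine le_of_tendsto' hlim fun m => ?_
    have h := hbox m
    rw [measureReal_def] at h
    exact (ENNReal.le_ofReal_iff_toReal_le (measure_ne_top _ _) hBd0).2 h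
  rw [measureReal_def]
  exact ENNReal.toReal_le_of_le_ofReal hBd0 hle

/-! ## §2 All moments of the IIC volume, upper bound -/

open Classical in
/-- **KESTEN'S THEOREM (8), UPPER HALF, EVERY MOMENT, ON `ℤ^d` UNDER (A2)□** (`p_c(ℤ^d)`, `d ≥ 2`, (A2)□ at `(s,L)`, `2 ≤ s ≤ L`,
`ϰ > 0`): for every `t` there is `C > 0` such that for every finite measure `ν` with Kesten's IIC limit property and every `n ≥ 1`,
`E_ν|C(0) ∩ Λ(n)|^{t+1} ≤ C · (n^d π_{p_c}(n))^{t+1}`. [cite: Kesten1986, Thm. (8)] [cite: BasuSapozhnikov2017ECP, Thm. 1.1] -/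
theorem iicMeasure_integral_volume_pow_le (hd : 2 ≤ d) {s L : ℕ} (hs : 2 ≤ s) (hsL : s ≤ L) {ϰ : ℝ} (hϰ : 0 < ϰ)
    (h : SetToSetQuasiMultAspectAt d (criticalProbI d) s L ϰ) (t : ℕ) :
    ∃ C : ℝ, 0 < C ∧ ∀ (ν : Measure (BondConfig (Site d))) [IsFiniteMeasure ν],
      (∀ (K : Finset (Sym2 (Site d))) (E : Set (BondConfig (Site d))), MeasurableSet E → DeterminedBy E ↑K →
        Tendsto (fun n : ℕ => (bondPercolation (zdGraph d) (criticalProbI d)).real (E ∩ siteToBoundary d n) /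
          oneArmProb d (criticalProbI d) n) atTop (𝓝 (ν.real E))) →
      ∀ n : ℕ, 1 ≤ n →
        ∫ ω, ((((box d n).filter fun z => ω ∈ (openConn (0 : Site d) z : Set (BondConfig (Site d)))).card : ℕ) : ℝ) ^ (t + 1) ∂ν ≤
          C * ((n : ℝ) ^ d * oneArmProb d (criticalProbI d) n) ^ (t + 1) := by
  classical
  have hd1 : 1 ≤ d := by omega
  obtain ⟨A, A', B, hA, hA', hR1, hRlin, hR2, hpc, hπ1⟩ := exists_ratios_of_setToSetQuasiMultAspectAt hd hs hsL hϰ h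
  obtain ⟨c, hc, hQM⟩ := oneArmQuasiMultAt_of_setToSetQuasiMultAspectAt hd hs hsL hϰ h
  obtain ⟨C, hC, hle⟩ := exists_sum_piFinset_weight_le hd1 (criticalProbI d) hpc hA hA' hR1 hRlin hR2 hπ1 t
  have hB0 : 0 < B := by
    have h1 := hR2 1 1 le_rfl le_rfl (by norm_num)
    nlinarith
  refine ⟨C * B / c, by positivity, fun ν _ hν n hn => ?_⟩
  have hπ : ∀ m, 0 < oneArmProb d (criticalProbI d) m := oneArmProb_pos hd1 _ hpc
  rw [integral_card_filter_pow_eq_sum ν (box d n) _ (fun z _ => measurableSet_openConn_holds (0 : Site d) z) (t + 1)]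
  have hr2 : oneArmProb d (criticalProbI d) n ≤ B * oneArmProb d (criticalProbI d) (2 * n + 1) :=
    hR2 n (2 * n + 1) hn (by omega) (by omega)
  have hs0 : 0 ≤ ((n : ℝ) ^ d * oneArmProb d (criticalProbI d) n) ^ (t + 1) :=
    pow_nonneg (mul_nonneg (pow_nonneg (Nat.cast_nonneg n) d) (hπ n).le) _
  calc ∑ q ∈ Fintype.piFinset (fun _ : Fin (t + 1) => box d n),
          ν.real (⋂ i, (openConn (0 : Site d) (q i) : Set (BondConfig (Site d))))
      ≤ ∑ q ∈ Fintype.piFinset (fun _ : Fin (t + 1) => box d n),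
          (∏ x ∈ insert (0 : Site d) (Finset.univ.image q),
            oneArmProb d (criticalProbI d) ((((Finset.erase (insert (0 : Site d) (Finset.univ.image q)) x).inf
              (fun w => ((Site.supNorm (x - w) : ℕ) : ℕ∞))).toNat - 1) / 2)) / (c * oneArmProb d (criticalProbI d) (2 * n + 1)) :=
        Finset.sum_le_sum fun q hq => iicMeasure_real_iInter_openConn_le hd1 _ hpc hc hQM hν hq
    _ = (∑ q ∈ Fintype.piFinset (fun _ : Fin (t + 1) => box d n),
          ∏ x ∈ insert (0 : Site d) (Finset.univ.image q),
            oneArmProb d (criticalProbI d) ((((Finset.erase (insert (0 : Site d) (Finset.univ.image q)) x).inf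
              (fun w => ((Site.supNorm (x - w) : ℕ) : ℕ∞))).toNat - 1) / 2)) / (c * oneArmProb d (criticalProbI d) (2 * n + 1)) := by
        rw [Finset.sum_div]
    _ ≤ C * (((n : ℝ) ^ d * oneArmProb d (criticalProbI d) n) ^ (t + 1) * oneArmProb d (criticalProbI d) n) /
          (c * oneArmProb d (criticalProbI d) (2 * n + 1)) :=
        div_le_div_of_nonneg_right (hle n hn) (mul_nonneg hc.le (hπ _).le)
    _ ≤ C * (((n : ℝ) ^ d * oneArmProb d (criticalProbI d) n) ^ (t + 1) * (B * oneArmProb d (criticalProbI d) (2 * n + 1))) /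
          (c * oneArmProb d (criticalProbI d) (2 * n + 1)) :=
        div_le_div_of_nonneg_right (mul_le_mul_of_nonneg_left (mul_le_mul_of_nonneg_left hr2 hs0) hC.le)
          (mul_nonneg hc.le (hπ _).le)
    _ = C * B / c * ((n : ℝ) ^ d * oneArmProb d (criticalProbI d) n) ^ (t + 1) := by
        have hπ2 : oneArmProb d (criticalProbI d) (2 * n + 1) ≠ 0 := (hπ _).ne'
        field_simp

open Classical in
/-- **SUPER-POLYNOMIAL UPPER TAIL OF THE IIC VOLUME UNDER (A2)□** (`p_c(ℤ^d)`, `d ≥ 2`, (A2)□ at `(s,L)`): for every `t` there is `C > 0`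
such that for every finite measure `ν` with Kesten's IIC limit property, all `n ≥ 1` and `λ > 0`,
`ν{λ · n^d π_{p_c}(n) ≤ |C(0) ∩ Λ(n)|} ≤ C · λ^{−(t+1)}` (Markov on §2). [cite: Kesten1986, Thm. (8)] -/
theorem iicMeasure_real_volume_ge_le (hd : 2 ≤ d) {s L : ℕ} (hs : 2 ≤ s) (hsL : s ≤ L) {ϰ : ℝ} (hϰ : 0 < ϰ)
    (h : SetToSetQuasiMultAspectAt d (criticalProbI d) s L ϰ) (t : ℕ) :
    ∃ C : ℝ, 0 < C ∧ ∀ (ν : Measure (BondConfig (Site d))) [IsFiniteMeasure ν],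
      (∀ (K : Finset (Sym2 (Site d))) (E : Set (BondConfig (Site d))), MeasurableSet E → DeterminedBy E ↑K →
        Tendsto (fun n : ℕ => (bondPercolation (zdGraph d) (criticalProbI d)).real (E ∩ siteToBoundary d n) /
          oneArmProb d (criticalProbI d) n) atTop (𝓝 (ν.real E))) →
      ∀ (n : ℕ) (lam : ℝ), 1 ≤ n → 0 < lam →
        ν.real {ω | lam * ((n : ℝ) ^ d * oneArmProb d (criticalProbI d) n) ≤
            ((((box d n).filter fun z => ω ∈ (openConn (0 : Site d) z : Set (BondConfig (Site d)))).card : ℕ) : ℝ)} ≤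
          C / lam ^ (t + 1) := by
  classical
  have hd1 : 1 ≤ d := by omega
  obtain ⟨C, hC, hle⟩ := iicMeasure_integral_volume_pow_le hd hs hsL hϰ h t
  have hpc : 0 < ((criticalProbI d : unitInterval) : ℝ) := by rw [coe_criticalProbI]; exact criticalProb_zd_pos d hd1
  refine ⟨C, hC, fun ν _ hν n lam hn hlam => ?_⟩
  have hn0 : (0 : ℝ) < n := by exact_mod_cast hn
  set sn : ℝ := (n : ℝ) ^ d * oneArmProb d (criticalProbI d) n with hsn
  have hsn0 : 0 < sn := mul_pos (pow_pos hn0 d) (oneArmProb_pos hd1 _ hpc n)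
  have ha0 : 0 ≤ lam * sn := (mul_pos hlam hsn0).le
  have hmk := pow_mul_real_le_setIntegral_volume_pow ν n (t + 1) ha0 Set.univ
  rw [Set.inter_univ, Measure.restrict_univ] at hmk
  have hchain : (lam * sn) ^ (t + 1) * ν.real {ω | lam * sn ≤
      ((((box d n).filter fun z => ω ∈ (openConn (0 : Site d) z : Set (BondConfig (Site d)))).card : ℕ) : ℝ)} ≤ C * sn ^ (t + 1) :=
    hmk.trans (hle ν hν n hn)
  have hlt : 0 < lam ^ (t + 1) * sn ^ (t + 1) := mul_pos (pow_pos hlam _) (pow_pos hsn0 _)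
  rw [mul_pow] at hchain
  rw [le_div_iff₀ (pow_pos hlam _)]
  have hsnpos : 0 < sn ^ (t + 1) := pow_pos hsn0 _
  nlinarith [hchain, hsnpos, measureReal_nonneg (μ := ν) (s := {ω | lam * sn ≤
      ((((box d n).filter fun z => ω ∈ (openConn (0 : Site d) z : Set (BondConfig (Site d)))).card : ℕ) : ℝ)})]

/-! ## §3 Kesten's Theorem (8) for the IIC, all moments, two-sided -/

open Classical in
/-- **KESTEN'S THEOREM (8) ON `ℤ^d`, ALL MOMENTS, TWO-SIDED** (`p_c(ℤ^d)`, `d ≥ 2`; (A2)□ at `(s,L)`, `2 ≤ s ≤ L`, `ϰ > 0`; tightness of the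
annulus crossing-cluster count `N(n, C₀n)` at one aspect `C₀ ≥ 2`; `ν` a probability measure with Kesten's IIC limit property): for every
`t` there are `0 < c, C` with, for all `n ≥ C₀`,
`c · (n^d π_{p_c}(n))^{t+1} ≤ E_ν|C(0) ∩ Λ(n)|^{t+1} ≤ C · (n^d π_{p_c}(n))^{t+1}`
— the upper half is §2 ((A2)□ alone), the lower half is Markov on gen 20's lower tail `c ≤ ν{λ(2n+1)^dπ(n) ≤ |C(0) ∩ Λ(n)|}`.
[cite: Kesten1986, Thm. (8)] [cite: BorgsChayesKestenSpencer2001, Thm. 1.1 (i)] [cite: BasuSapozhnikov2017ECP, Thm. 1.1] -/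
theorem iicMeasure_integral_volume_pow_two_sided (hd : 2 ≤ d) {s L : ℕ} (hs : 2 ≤ s) (hsL : s ≤ L) {ϰ : ℝ} (hϰ : 0 < ϰ)
    (h : SetToSetQuasiMultAspectAt d (criticalProbI d) s L ϰ) {C₀ : ℕ} (hC₀ : 2 ≤ C₀)
    (hT : ∀ ε : ℝ, 0 < ε → ∃ k : ℕ, ∀ n : ℕ, 1 ≤ n →
      (bondPercolation (zdGraph d) (criticalProbI d)).real {ω | (k : ℕ∞) < annulusClusterCount d n (C₀ * n) ω} ≤ ε)
    {ν : Measure (BondConfig (Site d))} [IsProbabilityMeasure ν]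
    (hν : ∀ (K : Finset (Sym2 (Site d))) (E : Set (BondConfig (Site d))), MeasurableSet E → DeterminedBy E ↑K →
      Tendsto (fun n : ℕ => (bondPercolation (zdGraph d) (criticalProbI d)).real (E ∩ siteToBoundary d n) /
        oneArmProb d (criticalProbI d) n) atTop (𝓝 (ν.real E))) (t : ℕ) :
    ∃ c C : ℝ, 0 < c ∧ 0 < C ∧ ∀ n : ℕ, C₀ ≤ n →
      c * ((n : ℝ) ^ d * oneArmProb d (criticalProbI d) n) ^ (t + 1) ≤
        ∫ ω, ((((box d n).filter fun z => ω ∈ (openConn (0 : Site d) z : Set (BondConfig (Site d)))).card : ℕ) : ℝ) ^ (t + 1) ∂ν ∧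
      ∫ ω, ((((box d n).filter fun z => ω ∈ (openConn (0 : Site d) z : Set (BondConfig (Site d)))).card : ℕ) : ℝ) ^ (t + 1) ∂ν ≤
        C * ((n : ℝ) ^ d * oneArmProb d (criticalProbI d) n) ^ (t + 1) := by
  classical
  obtain ⟨C, hC, hup⟩ := iicMeasure_integral_volume_pow_le hd hs hsL hϰ h t
  obtain ⟨lam, c, hlam, hc, hvol⟩ := le_iicMeasure_real_volume_ge hd hs hsL hϰ h hC₀ hT hν
  refine ⟨lam ^ (t + 1) * c, C, by positivity, hC, fun n hn => ⟨?_, hup ν hν n (by omega)⟩⟩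
  have hπn : 0 ≤ oneArmProb d (criticalProbI d) n := measureReal_nonneg
  have hn0 : (0 : ℝ) ≤ n := Nat.cast_nonneg n
  set a : ℝ := lam * (2 * (n : ℝ) + 1) ^ d * oneArmProb d (criticalProbI d) n with ha
  have ha0 : 0 ≤ a := by rw [ha]; exact mul_nonneg (mul_nonneg hlam.le (pow_nonneg (by linarith) d)) hπn
  have hmk := pow_mul_real_le_setIntegral_volume_pow ν n (t + 1) ha0 Set.univ
  rw [Set.inter_univ, Measure.restrict_univ] at hmk
  have hcmp : ((n : ℝ) ^ d * oneArmProb d (criticalProbI d) n) ^ (t + 1) ≤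
      ((2 * (n : ℝ) + 1) ^ d * oneArmProb d (criticalProbI d) n) ^ (t + 1) := by
    refine pow_le_pow_left₀ (mul_nonneg (pow_nonneg hn0 d) hπn) ?_ _
    exact mul_le_mul_of_nonneg_right (pow_le_pow_left₀ hn0 (by linarith) d) hπn
  calc lam ^ (t + 1) * c * ((n : ℝ) ^ d * oneArmProb d (criticalProbI d) n) ^ (t + 1)
      ≤ lam ^ (t + 1) * c * ((2 * (n : ℝ) + 1) ^ d * oneArmProb d (criticalProbI d) n) ^ (t + 1) :=
        mul_le_mul_of_nonneg_left hcmp (mul_nonneg (pow_nonneg hlam.le _) hc.le)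
    _ = a ^ (t + 1) * c := by rw [ha, mul_assoc lam, mul_pow]; ring
    _ ≤ a ^ (t + 1) * ν.real {ω | a ≤ ((((box d n).filter fun z =>
          ω ∈ (openConn (0 : Site d) z : Set (BondConfig (Site d)))).card : ℕ) : ℝ)} :=
        mul_le_mul_of_nonneg_left (hvol n hn) (pow_nonneg ha0 _)
    _ ≤ _ := hmk

open Classical in
/-- **KESTEN'S THEOREM (8) ON `ℤ^d`, ALL MOMENTS, PACKAGED WITH EXISTENCE** (`p_c(ℤ^d)`, `d ≥ 2`; (A2)□ at `(s,L)`; tightness of `N(n,C₀n)`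
at one `C₀ ≥ 2`): there is a probability measure `ν` with Kesten's IIC limit property at `p_c(ℤ^d)` (p1: existence under (A2)□, uses
p205010) such that for every `t` there are `0 < c, C` with `c s(n)^{t+1} ≤ E_ν|C(0) ∩ Λ(n)|^{t+1} ≤ C s(n)^{t+1}` for all `n ≥ C₀`,
`s(n) = n^d π_{p_c}(n)`. [cite: Kesten1986, Thm. (8)] [cite: BorgsChayesKestenSpencer2001, Thm. 1.1 (i)] -/
theorem exists_iicMeasure_volume_pow_two_sided (hd : 2 ≤ d) {s L : ℕ} (hs : 2 ≤ s) (hsL : s ≤ L) {ϰ : ℝ} (hϰ : 0 < ϰ)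
    (h : SetToSetQuasiMultAspectAt d (criticalProbI d) s L ϰ) {C₀ : ℕ} (hC₀ : 2 ≤ C₀)
    (hT : ∀ ε : ℝ, 0 < ε → ∃ k : ℕ, ∀ n : ℕ, 1 ≤ n →
      (bondPercolation (zdGraph d) (criticalProbI d)).real {ω | (k : ℕ∞) < annulusClusterCount d n (C₀ * n) ω} ≤ ε) :
    ∃ ν : Measure (BondConfig (Site d)), IsProbabilityMeasure ν ∧
      (∀ (K : Finset (Sym2 (Site d))) (E : Set (BondConfig (Site d))), MeasurableSet E → DeterminedBy E ↑K →
        Tendsto (fun n : ℕ => (bondPercolation (zdGraph d) (criticalProbI d)).real (E ∩ siteToBoundary d n) /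
          oneArmProb d (criticalProbI d) n) atTop (𝓝 (ν.real E))) ∧
      ∀ t : ℕ, ∃ c C : ℝ, 0 < c ∧ 0 < C ∧ ∀ n : ℕ, C₀ ≤ n →
        c * ((n : ℝ) ^ d * oneArmProb d (criticalProbI d) n) ^ (t + 1) ≤
          ∫ ω, ((((box d n).filter fun z => ω ∈ (openConn (0 : Site d) z : Set (BondConfig (Site d)))).card : ℕ) : ℝ) ^ (t + 1) ∂ν ∧
        ∫ ω, ((((box d n).filter fun z => ω ∈ (openConn (0 : Site d) z : Set (BondConfig (Site d)))).card : ℕ) : ℝ) ^ (t + 1) ∂ν ≤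
          C * ((n : ℝ) ^ d * oneArmProb d (criticalProbI d) n) ^ (t + 1) := by
  have hd1 : 1 ≤ d := by omega
  have hpc : 0 < ((criticalProbI d : unitInterval) : ℝ) := by rw [coe_criticalProbI]; exact criticalProb_zd_pos d hd1
  have hex := kestenIICExistsAt_criticalProbI_of_setToSetQuasiMultAspectAt hd hs hϰ h
  obtain ⟨ν, hνprob, hν⟩ := exists_iicMeasure_of_kestenIICExistsAt hd1 (criticalProbI d) hpc hex
  exact ⟨ν, hνprob, hν, fun t => iicMeasure_integral_volume_pow_two_sided hd hs hsL hϰ h hC₀ hT hν t⟩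

open Classical in
/-- **`ℤ³`: (A2)□ + `AnnulusClusterCountTight` ⇒ Kesten's (8), all moments, for the IIC of `ℤ³`.**
[cite: Kesten1986, Thm. (8)] [cite: BorgsChayesKestenSpencer1999, §1 (tightness postulate)] -/
theorem exists_iicMeasure_volume_pow_Z3_of_annulusClusterCountTight {s L : ℕ} (hs : 2 ≤ s) (hsL : s ≤ L) {ϰ : ℝ} (hϰ : 0 < ϰ)
    (h : SetToSetQuasiMultAspectAt 3 (criticalProbI 3) s L ϰ) (hT : AnnulusClusterCountTight) :
    ∃ ν : Measure (BondConfig (Site 3)), IsProbabilityMeasure ν ∧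
      (∀ (K : Finset (Sym2 (Site 3))) (E : Set (BondConfig (Site 3))), MeasurableSet E → DeterminedBy E ↑K →
        Tendsto (fun n : ℕ => (bondPercolation (zdGraph 3) (criticalProbI 3)).real (E ∩ siteToBoundary 3 n) /
          oneArmProb 3 (criticalProbI 3) n) atTop (𝓝 (ν.real E))) ∧
      ∀ t : ℕ, ∃ c C : ℝ, 0 < c ∧ 0 < C ∧ ∀ n : ℕ, 2 ≤ n →
        c * ((n : ℝ) ^ 3 * oneArmProb 3 (criticalProbI 3) n) ^ (t + 1) ≤
          ∫ ω, ((((box 3 n).filter fun z => ω ∈ (openConn (0 : Site 3) z : Set (BondConfig (Site 3)))).card : ℕ) : ℝ) ^ (t + 1) ∂ν ∧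
        ∫ ω, ((((box 3 n).filter fun z => ω ∈ (openConn (0 : Site 3) z : Set (BondConfig (Site 3)))).card : ℕ) : ℝ) ^ (t + 1) ∂ν ≤
          C * ((n : ℝ) ^ 3 * oneArmProb 3 (criticalProbI 3) n) ^ (t + 1) :=
  exists_iicMeasure_volume_pow_two_sided (d := 3) (by norm_num) hs hsL hϰ h (C₀ := 2) le_rfl hT

/-! ## §4 The planar case, unconditionally -/

open Classical in
/-- **KESTEN'S THEOREM (8) ON `ℤ²` FOR BOND PERCOLATION, ALL MOMENTS, UNCONDITIONALLY**: there is a probability measure `ν` with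
Kesten's IIC limit property at `p_c(ℤ²) = 1/2` such that for every `t` there are `0 < c, C` with
`c (n²π_{1/2}(n))^{t+1} ≤ E_ν|C(0) ∩ Λ(n)|^{t+1} ≤ C (n²π_{1/2}(n))^{t+1}` for all `n ≥ 2`
(planar (A2)□ from RSW, p1 gen 6; planar count tightness from closed dual circuits, gen 20). [cite: Kesten1986, Thm. (8)] -/
theorem exists_iicMeasure_volume_pow_two_sided_Z2 :
    ∃ ν : Measure (BondConfig (Site 2)), IsProbabilityMeasure ν ∧
      (∀ (K : Finset (Sym2 (Site 2))) (E : Set (BondConfig (Site 2))), MeasurableSet E → DeterminedBy E ↑K →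
        Tendsto (fun n : ℕ => (bondPercolation (zdGraph 2) (criticalProbI 2)).real (E ∩ siteToBoundary 2 n) /
          oneArmProb 2 (criticalProbI 2) n) atTop (𝓝 (ν.real E))) ∧
      ∀ t : ℕ, ∃ c C : ℝ, 0 < c ∧ 0 < C ∧ ∀ n : ℕ, 2 ≤ n →
        c * ((n : ℝ) ^ 2 * oneArmProb 2 (criticalProbI 2) n) ^ (t + 1) ≤
          ∫ ω, ((((box 2 n).filter fun z => ω ∈ (openConn (0 : Site 2) z : Set (BondConfig (Site 2)))).card : ℕ) : ℝ) ^ (t + 1) ∂ν ∧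
        ∫ ω, ((((box 2 n).filter fun z => ω ∈ (openConn (0 : Site 2) z : Set (BondConfig (Site 2)))).card : ℕ) : ℝ) ^ (t + 1) ∂ν ≤
          C * ((n : ℝ) ^ 2 * oneArmProb 2 (criticalProbI 2) n) ^ (t + 1) := by
  obtain ⟨ϰ, hϰ, hA2⟩ := exists_setToSetQuasiMultAspectAt_two_of_criticalProbI_le
  exact exists_iicMeasure_volume_pow_two_sided (d := 2) le_rfl (by norm_num) (by norm_num) hϰ (hA2 _ le_rfl) (C₀ := 2) le_rfl
    annulusClusterCount_tight_Z2

end Rsw3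

end Summit.CriticalPhenomena.PercolationContinuityZ3.Theorems
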